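import Summits.Schanuel.Schanuel.Theorems.RootDecomp1KGeneric19

/-!
# RootDecomp1K — lens 6, generation 14: the LOG-SQUARE CARVING (LogSq.lean v3 efa85398…) — continuation (RootDecomp1KGeneric20): §4c off-axis rational cells: one coordinate log-square Liouville, the other rational (`sb_two_of_logSqLiouville_re_rat_im` / `_im_rat_re`, `coordLiouvilleSchanuel_two_of_logSq_ratCoord`, split `coordLiouvilleSchanuel_two_split_ratCoord`)

(lens-6 g14 `LogSq.lean` v3, sha256 efa85398…, 1497 l, farm rc 0 · 0 warn · 0 sorry; port by census-1 gen 12 in five parts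
RootDecomp1KGeneric17–21 at the section cuts named in CENSUS-REQUEST 2026-08-30T23:30:45Z; each part imports the previous;
everything mod the cited fact `NesterenkoWaldschmidt1996_thm_1` where marked, otherwise hypothesis-free; `--supports stmt-Schanuel-31077`.)
-/

set_option linter.unusedSectionVars false

noncomputable section

open Complex Polynomial

namespace Summit.Schanuel.Schanuel.Theorems.RootDecomp1KGeneric

open Summit.Schanuel.Schanuel.Theorems.RootDecomp1KHyper
open Summit.Schanuel.Schanuel.Theorems.RootDecomp1KHyper.HyperCell
open Literature.NumberTheory.Transcendental (NesterenkoWaldschmidt1996_thm_1 weilHeight₁)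

variable {K : ℕ}

/-- The Mahler measure of a non-zero integer polynomial (over `ℂ`) is at least `1`. -/
private theorem one_le_mahlerMeasure_int {R : ℤ[X]} (hR : R ≠ 0) :
    1 ≤ (R.map (Int.castRingHom ℂ)).mahlerMeasure := by
  refine one_le_mahlerMeasure_of_one_le_norm_leadingCoeff ?_
  rw [Polynomial.leadingCoeff_map_of_injective (RingHom.injective_int _), eq_intCast,
    Complex.norm_intCast]
  exact_mod_cast Int.one_le_abs (Polynomial.leadingCoeff_ne_zero.mpr hR)

/-! ### §4c  Off-axis rational cells: ONE coordinate log-square Liouville, the OTHER coordinate rational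

The axis cells of §4/§4b are the case `s = 0` of the following: if the ℚ-span of the pair contains
`w = ℓ + i s` or `w = s + i ℓ` with `ℓ` log-square Liouville and `s ∈ ℚ`, the kernel applies at
`u = M w` with the Gaussian-rational approximants `β_r = r + i M s` / `M s + i r` (degree `≤ 2`,
`log M ≤ 2 log(|p|+q) + O_s(1) ≤ C_s log(|p|+q)`), and Schanuel's bound holds at the pair (mod NW96). -/

/-- Clearing denominators in a span membership: `M w = a z₀ + b z₁` with `M ≥ 1`, `a, b ∈ ℤ`. -/
private theorem exists_int_combo_of_mem_span {z : Fin 2 → ℂ} {w : ℂ}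
    (hw : w ∈ Submodule.span ℚ (Set.range z)) :
    ∃ (M : ℕ) (a b : ℤ), 1 ≤ M ∧ (M : ℂ) * w = (a : ℂ) * z 0 + (b : ℂ) * z 1 := by
  obtain ⟨cf, hcf⟩ := (Submodule.mem_span_range_iff_exists_fun ℚ).mp hw
  have hsum : ((cf 0 : ℚ) : ℂ) * z 0 + ((cf 1 : ℚ) : ℂ) * z 1 = w := by
    simpa [Fin.sum_univ_two, Rat.smul_def] using hcf
  set M : ℕ := (cf 0).den * (cf 1).den with hM
  have hM1 : 1 ≤ M := Nat.mul_pos (cf 0).den_pos (cf 1).den_pos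
  set a : ℤ := (cf 0).num * (cf 1).den with ha
  set b : ℤ := (cf 1).num * (cf 0).den with hb
  have hMa : (M : ℚ) * cf 0 = a := by
    rw [hM, ha]; push_cast
    have h := Rat.mul_den_eq_num (cf 0)
    calc ((cf 0).den : ℚ) * (cf 1).den * cf 0 = (cf 0 * (cf 0).den) * (cf 1).den := by ring
      _ = (cf 0).num * (cf 1).den := by rw [h]
  have hMb : (M : ℚ) * cf 1 = b := by
    rw [hM, hb]; push_cast
    have h := Rat.mul_den_eq_num (cf 1)
    calc ((cf 0).den : ℚ) * (cf 1).den * cf 1 = (cf 1 * (cf 1).den) * (cf 0).den := by ring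
      _ = (cf 1).num * (cf 0).den := by rw [h]
  have ha' : (a : ℂ) = (M : ℂ) * ((cf 0 : ℚ) : ℂ) := by exact_mod_cast hMa.symm
  have hb' : (b : ℂ) = (M : ℂ) * ((cf 1 : ℚ) : ℂ) := by exact_mod_cast hMb.symm
  refine ⟨M, a, b, hM1, ?_⟩
  rw [ha', hb', ← hsum]; ring

/-- For rationals `a = p/q`, `b = t/d`: the Gaussian rational `a + ib` is a root of an irreducible
`g ∈ ℤ[X]` of degree `≤ 2` (a factor of `q²d²X² − 2pqd²X + (p²d² + t²q²)`) with
`log M(g) ≤ 2 log(|p| + q) + 2 log(|t| + d)`. -/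
private theorem gaussRat_poly_facts (a b : ℚ) :
    ∃ f : ℤ[X], Irreducible f ∧ 0 < f.natDegree ∧ f.natDegree ≤ 2 ∧
      aeval (((a : ℝ) : ℂ) + I * ((b : ℝ) : ℂ)) f = 0 ∧
      Real.log ((f.map (Int.castRingHom ℂ)).mahlerMeasure) ≤
        2 * Real.log ((|a.num| : ℝ) + a.den) + 2 * Real.log ((|b.num| : ℝ) + b.den) := by
  set β : ℂ := ((a : ℝ) : ℂ) + I * ((b : ℝ) : ℂ) with hβdef
  have hq0 : (a.den : ℤ) ≠ 0 := by exact_mod_cast a.den_pos.ne'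
  have hd0 : (b.den : ℤ) ≠ 0 := by exact_mod_cast b.den_pos.ne'
  -- opaque names for the three coefficients (keeps `simp` from splitting `C (⋯)`)
  obtain ⟨c2, hc2⟩ : ∃ c : ℤ, c = ((a.den : ℤ) * b.den) ^ 2 := ⟨_, rfl⟩
  obtain ⟨c1, hc1⟩ : ∃ c : ℤ, c = -(2 * a.num * a.den * (b.den : ℤ) ^ 2) := ⟨_, rfl⟩
  obtain ⟨c0, hc0⟩ : ∃ c : ℤ, c = a.num ^ 2 * (b.den : ℤ) ^ 2 + b.num ^ 2 * (a.den : ℤ) ^ 2 := ⟨_, rfl⟩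
  have hc2ne : c2 ≠ 0 := by rw [hc2]; exact pow_ne_zero 2 (mul_ne_zero hq0 hd0)
  set Q : ℤ[X] := C c2 * X ^ 2 + C c1 * X ^ 1 + C c0 with hQ
  have hQ2 : Q.coeff 2 = c2 := by
    rw [hQ, coeff_add, coeff_add, coeff_C_mul, coeff_C_mul, coeff_X_pow, coeff_X_pow, coeff_C]; simp
  have hQc1 : Q.coeff 1 = c1 := by
    rw [hQ, coeff_add, coeff_add, coeff_C_mul, coeff_C_mul, coeff_X_pow, coeff_X_pow, coeff_C]; simp
  have hQc0 : Q.coeff 0 = c0 := by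
    rw [hQ, coeff_add, coeff_add, coeff_C_mul, coeff_C_mul, coeff_X_pow, coeff_X_pow, coeff_C]; simp
  have hQ0 : Q ≠ 0 := by
    intro h
    have h2 := hQ2
    rw [h, coeff_zero] at h2
    exact hc2ne h2.symm
  have hQdeg : Q.natDegree ≤ 2 :=
    natDegree_add_le_of_degree_le
      (natDegree_add_le_of_degree_le (natDegree_C_mul_X_pow_le _ _)
        ((natDegree_C_mul_X_pow_le _ _).trans (by norm_num)))
      (by rw [natDegree_C]; exact Nat.zero_le _)
  have haa : (a : ℂ) * (a.den : ℂ) = (a.num : ℂ) := by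
    have h' : ((a * a.den : ℚ) : ℂ) = ((a.num : ℚ) : ℂ) := by rw [Rat.mul_den_eq_num]
    push_cast at h'
    exact h'
  have hbb : (b : ℂ) * (b.den : ℂ) = (b.num : ℂ) := by
    have h' : ((b * b.den : ℚ) : ℂ) = ((b.num : ℚ) : ℂ) := by rw [Rat.mul_den_eq_num]
    push_cast at h'
    exact h'
  have hQβ : aeval β Q = 0 := by
    have e : aeval β Q = (c2 : ℂ) * β ^ 2 + (c1 : ℂ) * β ^ 1 + (c0 : ℂ) := by
      rw [hQ]
      simp only [map_add, map_mul, map_pow, aeval_X, eq_intCast, map_intCast]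
    rw [e, hc2, hc1, hc0, hβdef]
    push_cast
    rw [← haa, ← hbb]
    linear_combination ((a.den : ℂ) ^ 2 * (b.den : ℂ) ^ 2 * (b : ℂ) ^ 2) * Complex.I_mul_I
  have hβalg : IsAlgebraic ℚ β := isAlgebraic_of_aeval_int hQ0 hQβ
  obtain ⟨g, hgirr, hgdeg, hgβ⟩ :=
    Literature.NumberTheory.Transcendental.NesterenkoWaldschmidt1996.exists_irreducible_int_aeval_eq_zero hβalg
  have hgQ : g ∣ Q := dvd_of_irreducible_of_common_root hgirr hgdeg hgβ hQβ
  have hgdeg2 : g.natDegree ≤ 2 := (natDegree_le_of_dvd hgQ hQ0).trans hQdeg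
  -- Mahler measures: `M(g) ≤ M(Q) ≤ Σ |coeff| ≤ ((|p|+q)(|t|+d))²`
  obtain ⟨h, hQgh⟩ := hgQ
  have hh0 : h ≠ 0 := by rintro rfl; rw [mul_zero] at hQgh; exact hQ0 hQgh
  have hMg : (g.map (Int.castRingHom ℂ)).mahlerMeasure ≤ (Q.map (Int.castRingHom ℂ)).mahlerMeasure := by
    rw [hQgh, Polynomial.map_mul, mahlerMeasure_mul]
    exact le_mul_of_one_le_right (mahlerMeasure_nonneg _) (one_le_mahlerMeasure_int hh0)
  set P : ℝ := |(a.num : ℝ)| with hP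
  set T : ℝ := |(b.num : ℝ)| with hT
  have hP0 : 0 ≤ P := abs_nonneg _
  have hT0 : 0 ≤ T := abs_nonneg _
  have hq1 : (1 : ℝ) ≤ a.den := by exact_mod_cast a.den_pos
  have hd1 : (1 : ℝ) ≤ b.den := by exact_mod_cast b.den_pos
  have hMQ : (Q.map (Int.castRingHom ℂ)).mahlerMeasure ≤ ((P + a.den) * (T + b.den)) ^ 2 := by
    refine (mahlerMeasure_le_sum_norm_coeff _).trans ?_
    have hlt : (Q.map (Int.castRingHom ℂ)).natDegree < 3 := by
      rw [natDegree_map_eq_of_injective (RingHom.injective_int _)]; omega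
    rw [sum_over_range' _ (fun _ => norm_zero) 3 hlt]
    simp only [Finset.sum_range_succ, Finset.sum_range_zero, coeff_map, eq_intCast,
      Complex.norm_intCast, hQc0, hQc1, hQ2, zero_add]
    rw [hc0, hc1, hc2]
    push_cast
    have e0 : |(a.num : ℝ) ^ 2 * (b.den : ℝ) ^ 2 + (b.num : ℝ) ^ 2 * (a.den : ℝ) ^ 2|
        = P ^ 2 * (b.den : ℝ) ^ 2 + T ^ 2 * (a.den : ℝ) ^ 2 := by
      rw [abs_of_nonneg (by positivity), hP, hT, sq_abs, sq_abs]
    have e1 : |(-(2 * (a.num : ℝ) * (a.den : ℝ) * (b.den : ℝ) ^ 2))| = 2 * P * a.den * (b.den : ℝ) ^ 2 := by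
      rw [abs_neg, hP]
      rw [show (2 : ℝ) * a.num * a.den * (b.den : ℝ) ^ 2 = (a.num : ℝ) * (2 * a.den * (b.den : ℝ) ^ 2) by ring,
        abs_mul, abs_of_nonneg (by positivity : (0 : ℝ) ≤ 2 * a.den * (b.den : ℝ) ^ 2)]
      ring
    have e2 : |((a.den : ℝ) * (b.den : ℝ)) ^ 2| = ((a.den : ℝ) * b.den) ^ 2 := abs_of_nonneg (by positivity)
    rw [e0, e1, e2]
    nlinarith [mul_nonneg (mul_nonneg hT0 (by positivity : (0:ℝ) ≤ 2 * b.den)) (sq_nonneg (P + a.den)),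
      mul_nonneg (sq_nonneg T) (by positivity : (0:ℝ) ≤ P ^ 2 + 2 * P * a.den)]
  have hMg1 := one_le_mahlerMeasure_int hgirr.ne_zero
  refine ⟨g, hgirr, hgdeg, hgdeg2, hgβ, ?_⟩
  have hPq : 0 < P + a.den := by linarith
  have hTd : 0 < T + b.den := by linarith
  calc Real.log ((g.map (Int.castRingHom ℂ)).mahlerMeasure)
      ≤ Real.log (((P + a.den) * (T + b.den)) ^ 2) := Real.log_le_log (by linarith) (hMg.trans hMQ)
    _ = 2 * Real.log (P + a.den) + 2 * Real.log (T + b.den) := by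
        rw [Real.log_pow, Real.log_mul hPq.ne' hTd.ne']; push_cast; ring

/-- Height absorption: for `r ≠ 0`, `2 log(|p|+q) + 2 log(|t|+d) ≤ (2 + 4(|t|+d)) log(|p|+q)`
(`log(|p|+q) ≥ log 2 > 1/2`, `log(|t|+d) ≤ |t|+d`). -/
private theorem height_absorb (r : ℚ) (hr0 : r ≠ 0) (s : ℚ) :
    2 * Real.log ((|r.num| : ℝ) + r.den) + 2 * Real.log ((|s.num| : ℝ) + s.den) ≤
      (2 + 4 * ((|s.num| : ℝ) + s.den)) * Real.log ((|r.num| : ℝ) + r.den) := by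
  have hq1 : (1 : ℝ) ≤ r.den := by exact_mod_cast r.den_pos
  have hp1 : (1 : ℝ) ≤ |(r.num : ℝ)| := by
    have h1 : (1 : ℤ) ≤ |r.num| := Int.one_le_abs (Rat.num_ne_zero.mpr hr0)
    have h2 : ((1 : ℤ) : ℝ) ≤ ((|r.num| : ℤ) : ℝ) := by exact_mod_cast h1
    simpa [Int.cast_abs] using h2
  have h2 : (2 : ℝ) ≤ |(r.num : ℝ)| + r.den := by linarith
  have hlog2 : (1 / 2 : ℝ) ≤ Real.log ((|r.num| : ℝ) + r.den) := by
    have h := Real.log_two_gt_d9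
    have h' := Real.log_le_log (by norm_num) h2
    linarith
  set S : ℝ := (|s.num| : ℝ) + s.den with hS
  have hS1 : (1 : ℝ) ≤ S := by
    have : (1 : ℝ) ≤ s.den := by exact_mod_cast s.den_pos
    rw [hS]; linarith [abs_nonneg (s.num : ℝ)]
  have hlogS : Real.log S ≤ S := by
    linarith [Real.log_le_sub_one_of_pos (by linarith : (0 : ℝ) < S)]
  have hkey : 4 * S * (1 / 2) ≤ 4 * S * Real.log ((|r.num| : ℝ) + r.den) :=
    mul_le_mul_of_nonneg_left hlog2 (by linarith)
  nlinarith [hkey, hlogS, hS1]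

/-- **Off-axis rational cell, real orientation (mod NW96).**  If the ℚ-span of the pair `z`
contains `w` with `w.re` log-square Liouville and `w.im = s ∈ ℚ`, Schanuel's bound holds at `z`:
with `M w = a z₀ + b z₁`, the numbers `M·w.re = M w − i M s` and `e^{Mw}` lie in `ℚ(z, e^z, i)` and
are independent (engine at `u = M w`, `β_r = r + i M s`).  `s = 0` is `sb_two_of_logSqLiouville_mem_span`. -/
theorem sb_two_of_logSqLiouville_re_rat_im (hNW : NesterenkoWaldschmidt1996_thm_1) {z : Fin 2 → ℂ}
    {w : ℂ} (hw : w ∈ Submodule.span ℚ (Set.range z)) (hre : LogSqLiouville w.re) (s : ℚ)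
    (him : w.im = s) : SB 2 z := by
  obtain ⟨M, a, b, hM1, e1⟩ := exists_int_combo_of_mem_span hw
  set ℓ : ℝ := (M : ℝ) * w.re with hℓdef
  have hℓ : LogSqLiouville ℓ := hre.nat_mul hM1
  set s' : ℚ := (M : ℚ) * s with hs'
  have hw' : w = ((w.re : ℝ) : ℂ) + I * ((s : ℝ) : ℂ) := by
    apply Complex.ext <;> simp [him]
  have hu : (M : ℂ) * w = (ℓ : ℂ) + I * ((s' : ℝ) : ℂ) := by
    rw [hw', hℓdef, hs']; push_cast; ring
  have hw0 : w ≠ 0 := fun h => hre.ne_zero (by simp [h])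
  have hM0 : (M : ℂ) ≠ 0 := by exact_mod_cast (by omega : M ≠ 0)
  have hu0 : (M : ℂ) * w ≠ 0 := mul_ne_zero hM0 hw0
  have hai : AlgebraicIndependent ℚ ![(ℓ : ℂ), cexp ((M : ℂ) * w)] := by
    by_contra hdep
    refine not_logSqPairApprox_of_NW hNW hu0 (logSqPairApprox_of_dependent_gen hℓ rfl hdep (dβ := 2)
      (fun r => ((r : ℝ) : ℂ) + I * ((s' : ℝ) : ℂ)) (2 + 4 * ((|s'.num| : ℝ) + s'.den))
      (by positivity) ?_ ?_)
    · intro r hr0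
      have hβ0 : ((r : ℝ) : ℂ) + I * ((s' : ℝ) : ℂ) ≠ 0 := by
        intro h
        have h1 := congrArg Complex.re h
        simp at h1
        exact hr0 h1
      obtain ⟨f, hfirr, hfdeg, hfdeg2, hfroot, hfM⟩ := gaussRat_poly_facts r s'
      exact ⟨f, hfirr, hfdeg, hfdeg2, hfroot, hβ0, hfM.trans (height_absorb r hr0 s')⟩
    · intro r
      rw [hu]
      have e : (ℓ : ℂ) + I * ((s' : ℝ) : ℂ) - (((r : ℝ) : ℂ) + I * ((s' : ℝ) : ℂ)) =
          ((ℓ - r : ℝ) : ℂ) := by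
        push_cast; ring
      rw [e, Complex.norm_real, Real.norm_eq_abs]
  -- membership in `ℚ(z, e^z, i)`
  have hI : I ∈ IntermediateField.adjoin ℚ (SFset z ∪ {I}) :=
    IntermediateField.subset_adjoin ℚ _ (Set.mem_union_right _ rfl)
  have hsK : ((s' : ℝ) : ℂ) ∈ IntermediateField.adjoin ℚ (SFset z ∪ {I}) := by
    rw [Complex.ofReal_ratCast, ← eq_ratCast (algebraMap ℚ ℂ) s']
    exact IntermediateField.algebraMap_mem _ s'
  have hMw : (M : ℂ) * w ∈ IntermediateField.adjoin ℚ (SFset z ∪ {I}) := by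
    rw [e1]
    exact add_mem (mul_mem (intCast_mem _ a) (mem_adjoin_SFset_I (Or.inl ⟨0, rfl⟩)))
      (mul_mem (intCast_mem _ b) (mem_adjoin_SFset_I (Or.inl ⟨1, rfl⟩)))
  have hmem1 : (ℓ : ℂ) ∈ IntermediateField.adjoin ℚ (SFset z ∪ {I}) := by
    have e : (ℓ : ℂ) = (M : ℂ) * w - I * ((s' : ℝ) : ℂ) := by rw [hu]; ring
    rw [e]; exact sub_mem hMw (mul_mem hI hsK)
  have hmem2 : cexp ((M : ℂ) * w) ∈ IntermediateField.adjoin ℚ (SFset z ∪ {I}) := by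
    rw [e1, Complex.exp_add, Complex.exp_int_mul, Complex.exp_int_mul]
    exact mul_mem (zpow_mem (mem_adjoin_SFset_I (Or.inr ⟨0, rfl⟩)) a)
      (zpow_mem (mem_adjoin_SFset_I (Or.inr ⟨1, rfl⟩)) b)
  exact sb_two_of_algebraicIndependent hai hmem1 hmem2

/-- **Off-axis rational cell, imaginary orientation (mod NW96).**  If the ℚ-span of the pair `z`
contains `w` with `w.im` log-square Liouville and `w.re = s ∈ ℚ`, Schanuel's bound holds at `z`
(engine at `u = M w = M s + i M·w.im`, `β_r = M s + i r`).  `s = 0` is the twin cell of §4b. -/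
theorem sb_two_of_logSqLiouville_im_rat_re (hNW : NesterenkoWaldschmidt1996_thm_1) {z : Fin 2 → ℂ}
    {w : ℂ} (hw : w ∈ Submodule.span ℚ (Set.range z)) (him : LogSqLiouville w.im) (s : ℚ)
    (hre : w.re = s) : SB 2 z := by
  obtain ⟨M, a, b, hM1, e1⟩ := exists_int_combo_of_mem_span hw
  set ℓ : ℝ := (M : ℝ) * w.im with hℓdef
  have hℓ : LogSqLiouville ℓ := him.nat_mul hM1
  set s' : ℚ := (M : ℚ) * s with hs'
  have hw' : w = ((s : ℝ) : ℂ) + I * ((w.im : ℝ) : ℂ) := by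
    apply Complex.ext <;> simp [hre]
  have hu : (M : ℂ) * w = ((s' : ℝ) : ℂ) + I * (ℓ : ℂ) := by
    rw [hw', hℓdef, hs']; push_cast; ring
  have hw0 : w ≠ 0 := fun h => him.ne_zero (by simp [h])
  have hM0 : (M : ℂ) ≠ 0 := by exact_mod_cast (by omega : M ≠ 0)
  have hu0 : (M : ℂ) * w ≠ 0 := mul_ne_zero hM0 hw0
  have hai : AlgebraicIndependent ℚ ![(ℓ : ℂ), cexp ((M : ℂ) * w)] := by
    by_contra hdep
    refine not_logSqPairApprox_of_NW hNW hu0 (logSqPairApprox_of_dependent_gen hℓ rfl hdep (dβ := 2)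
      (fun r => ((s' : ℝ) : ℂ) + I * ((r : ℝ) : ℂ)) (2 + 4 * ((|s'.num| : ℝ) + s'.den))
      (by positivity) ?_ ?_)
    · intro r hr0
      have hβ0 : ((s' : ℝ) : ℂ) + I * ((r : ℝ) : ℂ) ≠ 0 := by
        intro h
        have h1 := congrArg Complex.im h
        simp at h1
        exact hr0 h1
      obtain ⟨f, hfirr, hfdeg, hfdeg2, hfroot, hfM⟩ := gaussRat_poly_facts s' r
      refine ⟨f, hfirr, hfdeg, hfdeg2, hfroot, hβ0, hfM.trans ?_⟩
      linarith [height_absorb r hr0 s']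
    · intro r
      rw [hu]
      have e : ((s' : ℝ) : ℂ) + I * (ℓ : ℂ) - (((s' : ℝ) : ℂ) + I * ((r : ℝ) : ℂ)) =
          I * ((ℓ - r : ℝ) : ℂ) := by
        push_cast; ring
      rw [e, norm_mul, Complex.norm_I, one_mul, Complex.norm_real, Real.norm_eq_abs]
  have hI : I ∈ IntermediateField.adjoin ℚ (SFset z ∪ {I}) :=
    IntermediateField.subset_adjoin ℚ _ (Set.mem_union_right _ rfl)
  have hsK : ((s' : ℝ) : ℂ) ∈ IntermediateField.adjoin ℚ (SFset z ∪ {I}) := by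
    rw [Complex.ofReal_ratCast, ← eq_ratCast (algebraMap ℚ ℂ) s']
    exact IntermediateField.algebraMap_mem _ s'
  have hMw : (M : ℂ) * w ∈ IntermediateField.adjoin ℚ (SFset z ∪ {I}) := by
    rw [e1]
    exact add_mem (mul_mem (intCast_mem _ a) (mem_adjoin_SFset_I (Or.inl ⟨0, rfl⟩)))
      (mul_mem (intCast_mem _ b) (mem_adjoin_SFset_I (Or.inl ⟨1, rfl⟩)))
  have hmem1 : (ℓ : ℂ) ∈ IntermediateField.adjoin ℚ (SFset z ∪ {I}) := by
    have e : (ℓ : ℂ) = -I * ((M : ℂ) * w - ((s' : ℝ) : ℂ)) := by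
      rw [hu]; ring_nf; rw [Complex.I_sq]; ring
    rw [e]; exact mul_mem (neg_mem hI) (sub_mem hMw hsK)
  have hmem2 : cexp ((M : ℂ) * w) ∈ IntermediateField.adjoin ℚ (SFset z ∪ {I}) := by
    rw [e1, Complex.exp_add, Complex.exp_int_mul, Complex.exp_int_mul]
    exact mul_mem (zpow_mem (mem_adjoin_SFset_I (Or.inr ⟨0, rfl⟩)) a)
      (zpow_mem (mem_adjoin_SFset_I (Or.inr ⟨1, rfl⟩)) b)
  exact sb_two_of_algebraicIndependent hai hmem1 hmem2

/-- **Item 31077 at `n = 2`, sub-scope «the span contains `w` with one coordinate log-square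
Liouville and the other coordinate RATIONAL»: HOLDS (mod NW96).**  Contains the axis sub-scopes of
`coordLiouvilleSchanuel_two_of_logSq[_axis]` (other coordinate `0`). -/
theorem coordLiouvilleSchanuel_two_of_logSq_ratCoord (hNW : NesterenkoWaldschmidt1996_thm_1)
    (z : Fin 2 → ℂ) (_hz : LinearIndependent ℚ z)
    (hw : ∃ w ∈ Submodule.span ℚ (Set.range z),
      (LogSqLiouville w.re ∧ w.im ∈ Set.range (Rat.cast : ℚ → ℝ)) ∨
      (LogSqLiouville w.im ∧ w.re ∈ Set.range (Rat.cast : ℚ → ℝ))) : SB 2 z := by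
  obtain ⟨w, hw, h⟩ := hw
  rcases h with ⟨hre, s, hs⟩ | ⟨him, s, hs⟩
  · exact sb_two_of_logSqLiouville_re_rat_im hNW hw hre s hs.symm
  · exact sb_two_of_logSqLiouville_im_rat_re hNW hw him s hs.symm

/-- **The rational-coordinate carving of item 31077 at `n = 2` (formal split, mod NW96):
Target₂ ⟸ (rational-coordinate cell) ∧ Residual₂″**, the residual being «no `w` in the ℚ-span with
one coordinate rational and the other log-square Liouville» — it still contains `(ℓ_b, ℓ_b²)` (§5)
and every span all of whose Liouville members are genuinely off-axis-irrational. -/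
theorem coordLiouvilleSchanuel_two_split_ratCoord (hNW : NesterenkoWaldschmidt1996_thm_1)
    (hres : ∀ z : Fin 2 → ℂ, LinearIndependent ℚ z →
      (∃ w ∈ Submodule.span ℚ (Set.range z), Liouville w.re ∨ Liouville w.im) →
      (∀ w ∈ Submodule.span ℚ (Set.range z),
        (w.im ∈ Set.range (Rat.cast : ℚ → ℝ) → ¬ LogSqLiouville w.re) ∧
        (w.re ∈ Set.range (Rat.cast : ℚ → ℝ) → ¬ LogSqLiouville w.im)) → SB 2 z) :
    ∀ z : Fin 2 → ℂ, LinearIndependent ℚ z →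
      (∃ w ∈ Submodule.span ℚ (Set.range z), Liouville w.re ∨ Liouville w.im) → SB 2 z := by
  intro z hz hw
  by_cases h : ∃ w ∈ Submodule.span ℚ (Set.range z),
      (LogSqLiouville w.re ∧ w.im ∈ Set.range (Rat.cast : ℚ → ℝ)) ∨
      (LogSqLiouville w.im ∧ w.re ∈ Set.range (Rat.cast : ℚ → ℝ))
  · exact coordLiouvilleSchanuel_two_of_logSq_ratCoord hNW z hz h
  · push Not at h
    exact hres z hz hw (fun w hw' => ⟨fun him hre => (h w hw').1 hre him,
      fun hre him => (h w hw').2 him hre⟩)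

end Summit.Schanuel.Schanuel.Theorems.RootDecomp1KGeneric
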